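import Literature.NumberTheory.EllipticCurves.ModularParametrizationDegreeProofs
import Literature.NumberTheory.EllipticCurves.EichlerIntegralWeierstrassProofs
import Literature.NumberTheory.EllipticCurves.EichlerShimuraPeriods
import HarnessLib

/-!
# Poles of `℘_Λ(2πi∫f)`: finitely many `Γ₀(N)`-orbits, none near the cusps

Topic `NumberTheory/EllipticCurves`; a proofs-only file (theorems only, no definitions, no named
facts). Let `f ∈ S₂(Γ₀(N))` be nonzero, `u(τ) = 2πi ∫_{i∞}^τ f` its Eichler integral
(`eichlerIntegral f`) and `Λ = Λ(L)` a lattice containing the period lattice `Λ_f`. The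
`Γ₀(N)`-invariant meromorphic function `x(τ) = ℘_Λ(u(τ))` on `ℍ` has poles exactly on
`P = {τ : u(τ) ∈ Λ}`. This file proves the finiteness statements about `P` that underlie the
classical fact that `x` is a meromorphic function on the compact Riemann surface `X₀(N)`
(Shimura 1971, §2.4 and Thm. 7.14; Diamond–Shurman 2005, §2.4 and §3.1):

* `exists_forall_eichlerIntegral_smul_notMem` — **no poles near the cusps**: for every
  `g ∈ SL(2, ℤ)` there is `T` with `u(gτ) ∉ Λ` for `im τ ≥ T`. Indeed `u(gτ) = C_g + V_g(τ)`
  (`exists_eichlerIntegral_smul_eq`, Manin 1972, Prop. 1.4) with `V_g = 2πi∫(f ∣[2] g)` a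
  nonzero cuspidal `q_N`-series (`isCuspFunction_verticalIntegral_slash`), so `V_g(τ) → 0` and
  `V_g(τ) ≠ 0` for `im τ` large, while `Λ ∖ {C_g}` is closed and misses `C_g`.
* `eichlerIntegral_gamma_smul_mem_iff` — `P` is `Γ₀(N)`-stable (`u(γτ) − u(τ) ∈ Λ_f ⊆ Λ`).
* `exists_nhds_forall_eichlerIntegral_mem_imp_eq` — `P` is locally a single point
  (`u` is holomorphic and nowhere locally constant, `Λ` is discrete).
* `exists_finset_poles` — **`P` consists of finitely many `Γ₀(N)`-orbits**: reduction theory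
  (`exists_finset_smul_truncatedFundamentalDomain_cover`, Diamond–Shurman Lemma 2.3.1) places
  every point in `γg𝒟_M ∪ γg{im > M}`; above height `M` there are no poles, and the compact
  `⋃_g g𝒟_M` meets `P` in a finite set.

## References

* G. Shimura, *Introduction to the arithmetic theory of automorphic functions*, 1971: §2.4,
  Thm. 7.14. [ShimuraIATAF1971]
* F. Diamond, J. Shurman, *A First Course in Modular Forms*, GTM 228, 2005: Lemma 2.3.1, §2.4,
  §3.1. [DiamondShurman2005]
* Ju. I. Manin, *Parabolic points and zeta functions of modular curves*, 1972: Prop. 1.4.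
  [Manin1972]
* J. E. Cremona, *Algorithms for modular elliptic curves*, 2nd ed., 1997: §2.10.
  [CremonaAlgorithms1997]
-/

noncomputable section

open Complex Filter Topology Set Function
open UpperHalfPlane hiding I
open scoped Real Topology Manifold MatrixGroups PeriodPair ModularForm

open Literature.NumberTheory.EllipticCurves

namespace Literature.NumberTheory.EllipticCurves.ModularForms

open CongruenceSubgroup

variable {N : ℕ} [NeZero N]

/-! ### The Eichler integral near a cusp -/

/-- **`V_{f ∣ g} = 2πi ∫_{i∞}(f ∣[2] g)` is a cuspidal `q_N`-series** (a constant multiple of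
the primitive `∫_τ^{i∞}(f ∣[2] g)`, `IsCuspFunction.primitive`). [folklore] -/
theorem isCuspFunction_verticalIntegral_slash (f : CuspForm (Gamma0 N) 2) (g : SL(2, ℤ)) :
    IsCuspFunction N (verticalIntegral (⇑f ∣[(2 : ℤ)] g)) := by
  have hφ := isCuspFunction_slash f g
  have h2π : (2 * (Real.pi : ℂ)) ≠ 0 :=
    mul_ne_zero two_ne_zero (by exact_mod_cast Real.pi_ne_zero)
  have hπ : (2 * Real.pi / I : ℂ) * (I / (2 * Real.pi)) = 1 := by
    rw [div_mul_div_comm, mul_comm (2 * (Real.pi : ℂ)) I, div_self (mul_ne_zero I_ne_zero h2π)]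
  have heq : verticalIntegral (⇑f ∣[(2 : ℤ)] g) =
      (2 * Real.pi / I : ℂ) • eichlerPrimitive (⇑f ∣[(2 : ℤ)] g) := by
    funext τ
    rw [Pi.smul_apply, smul_eq_mul, eichlerPrimitive_eq, ← mul_assoc, hπ, one_mul]
  rw [heq]
  exact hφ.primitive.const_smul _

/-- For `f ≠ 0`, `V_{f ∣ g} ≠ 0` (its derivative is `2πi (f ∣[2] g) ≠ 0`). [folklore] -/
theorem verticalIntegral_slash_ne_zero (f : CuspForm (Gamma0 N) 2) (hf : f ≠ 0) (g : SL(2, ℤ)) :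
    verticalIntegral (⇑f ∣[(2 : ℤ)] g) ≠ 0 := by
  intro h0
  apply coe_slash_ne_zero f hf g
  funext τ
  have hφ := isCuspFunction_slash (k := 2) f g
  have hd := hφ.hasDerivAt_verticalIntegral τ.im_pos
  rw [h0] at hd
  have hd' : HasDerivAt (fun _ : ℂ ↦ (0 : ℂ))
      (2 * Real.pi * I * (⇑f ∣[(2 : ℤ)] g) (ofComplex (τ : ℂ))) (τ : ℂ) := hd
  have huniq := hd'.unique (hasDerivAt_const (τ : ℂ) (0 : ℂ))
  rw [ofComplex_apply] at huniq
  have h2πI : (2 * Real.pi * I : ℂ) ≠ 0 :=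
    mul_ne_zero (mul_ne_zero two_ne_zero (by exact_mod_cast Real.pi_ne_zero)) I_ne_zero
  exact (mul_eq_zero.mp huniq).resolve_left h2πI

/-- **No poles of `℘_Λ(u)` near the cusp `g∞`**: for `f ≠ 0`, `g ∈ SL(2, ℤ)` and any lattice
`Λ` there is `T` such that `u(gτ) ∉ Λ` whenever `im τ ≥ T`. (`u(gτ) = C_g + V_g(τ)` with
`V_g → 0` uniformly, `V_g ≠ 0` high in the cusp, and `Λ ∖ {C_g}` is closed and misses `C_g`.)
[cite: Manin1972, Prop. 1.4] -/
theorem exists_forall_eichlerIntegral_smul_notMem (f : CuspForm (Gamma0 N) 2) (hf : f ≠ 0)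
    (L : PeriodPair) (g : SL(2, ℤ)) :
    ∃ T : ℝ, ∀ τ : ℍ, T ≤ τ.im → eichlerIntegral f (g • τ) ∉ L.lattice := by
  obtain ⟨C, hC⟩ := exists_eichlerIntegral_smul_eq f g
  have hφ := isCuspFunction_slash (k := 2) f g
  obtain ⟨ε, hε, hball⟩ := Metric.mem_nhds_iff.mp (L.compl_lattice_sdiff_singleton_mem_nhds C)
  obtain ⟨M₁, hM₁⟩ := hφ.exists_forall_norm_verticalIntegral_le (half_pos hε)
  obtain ⟨M₂, hM₂⟩ := (isCuspFunction_verticalIntegral_slash f g).exists_forall_ne_zero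
    (verticalIntegral_slash_ne_zero f hf g)
  refine ⟨max M₁ M₂, fun τ hτ hmem ↦ ?_⟩
  have h1 := hM₁ τ ((le_max_left _ _).trans hτ)
  have h2 := hM₂ τ ((le_max_right _ _).trans hτ)
  have hin : C + verticalIntegral (⇑f ∣[(2 : ℤ)] g) τ ∈ Metric.ball C ε := by
    rw [Metric.mem_ball, dist_eq_norm, add_sub_cancel_left]
    linarith
  refine hball hin ⟨?_, fun h ↦ h2 ?_⟩
  · rw [SetLike.mem_coe, ← hC τ]
    exact hmem
  · simpa using h

/-! ### The pole set is `Γ₀(N)`-stable and locally finite -/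

/-- **The pole set is `Γ₀(N)`-stable**: if `Λ_f ⊆ Λ` then `u(γτ) ∈ Λ ↔ u(τ) ∈ Λ` for
`γ ∈ Γ₀(N)` (`u(γτ) − u(τ) ∈ Λ_f`, `eichlerIntegral_gamma_smul_holds`).
[cite: Manin1972, Prop. 1.4] -/
theorem eichlerIntegral_gamma_smul_mem_iff (f : CuspForm (Gamma0 N) 2) (L : PeriodPair)
    (hΛ : ∀ x ∈ periodLattice f, x ∈ L.lattice) (γ : Gamma0 N) (τ : ℍ) :
    eichlerIntegral f ((γ : SL(2, ℤ)) • τ) ∈ L.lattice ↔ eichlerIntegral f τ ∈ L.lattice := by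
  have hmem : eichlerIntegral f ((γ : SL(2, ℤ)) • τ) - eichlerIntegral f τ ∈ L.lattice :=
    hΛ _ (eichlerIntegral_gamma_smul_holds f γ τ)
  constructor
  · intro h
    simpa using sub_mem h hmem
  · intro h
    simpa using add_mem hmem h

/-- **The pole set is locally a single point**: every `τ₀ ∈ ℍ` has a neighbourhood `V` with
`u(τ) ∈ Λ, τ ∈ V ⇒ τ = τ₀` (for `f ≠ 0`: `u` is holomorphic and nowhere locally constant, so
`u(τ) ≠ u(τ₀)` on a punctured neighbourhood, and `Λ ∖ {u(τ₀)}` is closed). [folklore] -/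
theorem exists_nhds_forall_eichlerIntegral_mem_imp_eq (f : CuspForm (Gamma0 N) 2) (hf : f ≠ 0)
    (L : PeriodPair) (τ₀ : ℍ) :
    ∃ V ∈ 𝓝 τ₀, ∀ τ ∈ V, eichlerIntegral f τ ∈ L.lattice → τ = τ₀ := by
  set U : ℂ → ℂ := fun w ↦ eichlerIntegral f (ofComplex w) with hU
  have hz₀ : 0 < (τ₀ : ℂ).im := τ₀.im_pos
  have han : AnalyticAt ℂ U τ₀ := analyticAt_eichlerIntegral_comp_ofComplex f hz₀
  -- (i) near `τ₀` the values of `U` avoid `Λ ∖ {U τ₀}`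
  have h1 : ∀ᶠ w in 𝓝 (τ₀ : ℂ), U w ∈ ((L.lattice : Set ℂ) \ {U τ₀})ᶜ :=
    han.continuousAt.preimage_mem_nhds (L.compl_lattice_sdiff_singleton_mem_nhds (U τ₀))
  -- (ii) `U w ≠ U τ₀` on a punctured neighbourhood
  have h2 : ∀ᶠ w in 𝓝[≠] (τ₀ : ℂ), U w ≠ U τ₀ := by
    have han' : AnalyticAt ℂ (fun w ↦ U w - U τ₀) τ₀ := han.sub analyticAt_const
    rcases han'.eventually_eq_zero_or_eventually_ne_zero with h | h
    · exfalso
      apply not_eventually_const_eichlerIntegral f hf hz₀ (U τ₀)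
      filter_upwards [h] with w hw
      simpa [sub_eq_zero] using hw
    · filter_upwards [h] with w hw
      simpa [sub_eq_zero] using hw
  have h3 : ∀ᶠ w in 𝓝[≠] (τ₀ : ℂ), U w ∉ L.lattice := by
    filter_upwards [h2, nhdsWithin_le_nhds h1] with w hw2 hw1
    intro hw
    exact hw1 ⟨hw, hw2⟩
  have h4 : insert (τ₀ : ℂ) {w : ℂ | U w ∉ L.lattice} ∈ 𝓝 (τ₀ : ℂ) := by
    rw [insert_mem_nhds_iff]
    exact h3
  refine ⟨((↑) : ℍ → ℂ) ⁻¹' insert (τ₀ : ℂ) {w : ℂ | U w ∉ L.lattice},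
    continuous_coe.continuousAt.preimage_mem_nhds h4, fun τ hτ hmem ↦ ?_⟩
  rcases hτ with h | h
  · exact UpperHalfPlane.ext h
  · exact absurd hmem (by simpa [hU, ofComplex_apply] using h)

/-! ### Finitely many orbits of poles -/

/-- **The poles of `℘_Λ(u)` lie in finitely many `Γ₀(N)`-orbits**: for `f ≠ 0` and `Λ ⊇ Λ_f`
there is a finite set `S ⊆ {u ∈ Λ}` of poles such that every pole is `γs` with `γ ∈ Γ₀(N)`,
`s ∈ S`. (Reduction theory: every point is `γgz` with `g` in a finite set and `z` in the
compact truncated fundamental domain `𝒟_M` or of height `> M`; above height `M` no translate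
has poles, `exists_forall_eichlerIntegral_smul_notMem`, and the locally finite pole set meets
the compact `⋃_g g𝒟_M` in a finite set.) This is the finiteness of the set of poles of the
meromorphic function `x = ℘_Λ(u)` on `X₀(N)` (Shimura 1971, §2.4; Diamond–Shurman §3.1).
[cite: DiamondShurman2005, Lemma 2.3.1 and §3.1] -/
theorem exists_finset_poles (f : CuspForm (Gamma0 N) 2) (hf : f ≠ 0) (L : PeriodPair)
    (hΛ : ∀ x ∈ periodLattice f, x ∈ L.lattice) :
    ∃ S : Finset ℍ, (∀ s ∈ S, eichlerIntegral f s ∈ L.lattice) ∧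
      ∀ τ : ℍ, eichlerIntegral f τ ∈ L.lattice → ∃ γ ∈ Gamma0 N, ∃ s ∈ S, τ = γ • s := by
  classical
  obtain ⟨R, hR⟩ := exists_finset_smul_truncatedFundamentalDomain_cover (Gamma0 N)
  have hM : ∀ g ∈ R, ∀ᶠ M : ℝ in atTop, ∀ z : ℍ, M < z.im →
      eichlerIntegral f (g • z) ∉ L.lattice := by
    intro g _
    obtain ⟨T, hT⟩ := exists_forall_eichlerIntegral_smul_notMem f hf L g
    filter_upwards [eventually_ge_atTop T] with M hM z hz
    exact hT z (hM.trans hz.le)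
  obtain ⟨M, hM⟩ := ((R.eventually_all).mpr hM).exists
  have hK := isCompact_biUnion_smul_truncatedFundamentalDomain R M
  have hfin := finite_inter_of_forall_exists_nhds_eq
    (A := {τ : ℍ | eichlerIntegral f τ ∈ L.lattice}) hK
    fun x _ ↦ exists_nhds_forall_eichlerIntegral_mem_imp_eq f hf L x
  refine ⟨hfin.toFinset, fun s hs ↦ (hfin.mem_toFinset.mp hs).1, fun τ hτ ↦ ?_⟩
  obtain ⟨γ, hγ, g, hg, z, rfl, hz⟩ := hR M τ
  have h1 : eichlerIntegral f (g • z) ∈ L.lattice :=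
    (eichlerIntegral_gamma_smul_mem_iff f L hΛ ⟨γ, hγ⟩ (g • z)).mp hτ
  rcases hz with hz | hz
  · exact ⟨γ, hγ, g • z, hfin.mem_toFinset.mpr ⟨h1, mem_iUnion₂.mpr ⟨g, hg, z, hz, rfl⟩⟩, rfl⟩
  · exact absurd h1 (hM g hg z hz)

end Literature.NumberTheory.EllipticCurves.ModularForms

end
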